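import Summits.CriticalPhenomena.PercolationContinuityZ3.Theorems.PercNearOneGluingNoHeavyLowerTailApexTwoSumFans
import HarnessLib

/-!
# `NoHeavyLowerTail` (stmt-CriticalPhenomena-4575) — 2-sums through the apex, part 9:
# R1-RC on FAN PIECES (rim path with a spoke-less far end), every `q ≥ 1` — the pieces of a wheel's 3-sum

Support file (prover prim-gen-kcluster gen 72; `--supports stmt-CriticalPhenomena-4575`).  No definitions, no named
facts, no sorries.

THE FAN PIECE over a nonempty list `L = [v₁, …, v_L]` with far end `c`: apex `a`, rim path `v₁, …, v_L, c`, spokes `a v_i`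
to the list vertices only (NO spoke at `c`); support written inline as
`FP(a; L, c) = (L.map (s(a,·)) ++ zipWith s(·,·) (L ++ [c]) (L ++ [c]).tail).toFinset`.  Cutting a wheel with hub `a` at the
terminal triple `{a, b, c}` produces two such pieces (spokes `ab`, `ac` distributed one to each piece), so this is the piece
theorem needed for wheels (part 10, with `ThreeSum.r1_of_threeSum_of_r1`).

**THEOREM** (`ApexTwoSum.fanPiece_r1`).  For `q ≥ 1`, distinct vertices `x :: (l ++ [c])` avoiding `a`, and parameters positive
on `FP(a; x :: l, c)` and zero off it: R1 for the instance `(a; x, c)`.  Proof: induction on `l` exactly as for fans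
(`fan_r1`): two rim vertices = adjacent terminals; otherwise the 2-sum along `{a, y}` of the path `a – x – y` and the piece over
`y :: rest` (`r1_of_apexTwoSum`, FKG slacks for `q ≥ 1`, non-degeneracy from positivity — the far end `c` is reached in the
all-open configuration along the rim, `reach_fanPiece`).
-/

noncomputable section

namespace Summit.CriticalPhenomena.PercolationContinuityZ3.Theorems

namespace ApexTwoSum

open Finset SimpleGraph Literature.Probability.Percolation Literature.Probability.Percolation.Gladkov
open Literature.Probability.Percolation.BHK2006 (weight)
open Literature.Probability.Percolation.DecisionTree (ind ind_of_mem ind_of_not_mem ind_nonneg)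
open Literature.Probability.LatticeModels RefinedRowR3 ThreePointLB MeasureTheory
open scoped Classical

variable {V : Type*} [Fintype V]

/-! ### The fan-piece support -/

section Support

variable (a : V)

omit [Fintype V] in
/-- Spokes of list vertices belong to the support. [this work] -/
theorem spoke_mem_fanPiece {L : List V} {c y : V} (hy : y ∈ L) : s(a, y) ∈ (List.toFinset (List.map (fun y => s(a, y)) L ++ List.zipWith (fun y y' => s(y, y')) (L ++ [c]) (List.tail (L ++ [c])))) := by
  rw [List.mem_toFinset, List.mem_append, List.mem_map]
  exact Or.inl ⟨y, hy, rfl⟩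

omit [Fintype V] in
/-- The piece over one vertex: `FP(a; [x], c) = {a x, x c}`. [this work] -/
theorem mem_fanPiece_single {x c : V} {e : Sym2 V} : e ∈ (List.toFinset (List.map (fun y => s(a, y)) ([x]) ++ List.zipWith (fun y y' => s(y, y')) (([x]) ++ [c]) (List.tail (([x]) ++ [c])))) ↔ (e = s(a, x) ∨ e = s(x, c)) := by
  simp only [List.map_cons, List.map_nil, List.cons_append, List.nil_append, List.tail_cons,
    List.zipWith_cons_cons, List.zipWith_nil_right, List.mem_toFinset, List.mem_cons,
    List.not_mem_nil, or_false]

omit [Fintype V] in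
/-- Peeling the first rim vertex: `FP(a; x :: y :: r, c) = {a x, x y} ∪ FP(a; y :: r, c)`. [this work] -/
theorem mem_fanPiece_cons_cons {x y c : V} {r : List V} {e : Sym2 V} :
    e ∈ (List.toFinset (List.map (fun y => s(a, y)) (x :: y :: r) ++ List.zipWith (fun y y' => s(y, y')) ((x :: y :: r) ++ [c]) (List.tail ((x :: y :: r) ++ [c])))) ↔ ((e = s(a, x) ∨ e = s(x, y)) ∨ e ∈ (List.toFinset (List.map (fun y => s(a, y)) (y :: r) ++ List.zipWith (fun y y' => s(y, y')) ((y :: r) ++ [c]) (List.tail ((y :: r) ++ [c]))))) := by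
  simp only [List.map_cons, List.cons_append, List.tail_cons, List.zipWith_cons_cons, List.mem_toFinset,
    List.mem_append, List.mem_cons]
  tauto

omit [Fintype V] in
/-- Every vertex on a pair of the support is the apex, a list vertex or the far end. [this work] -/
theorem verts_fanPiece (c : V) : ∀ (L : List V), ∀ e ∈ (List.toFinset (List.map (fun y => s(a, y)) L ++ List.zipWith (fun y y' => s(y, y')) (L ++ [c]) (List.tail (L ++ [c])))), ∀ v ∈ e, v = a ∨ v ∈ L ∨ v = c := by
  intro L
  induction L with
  | nil =>
    intro e he
    simp only [List.map_nil, List.nil_append, List.tail_cons, List.zipWith_nil_right, List.append_nil,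
      List.toFinset_nil, Finset.notMem_empty] at he
  | cons y r ih =>
    cases r with
    | nil =>
      intro e he v hv
      rcases (mem_fanPiece_single a).1 he with rfl | rfl
      · rcases Sym2.mem_iff.1 hv with rfl | rfl
        · exact Or.inl rfl
        · exact Or.inr (Or.inl List.mem_cons_self)
      · rcases Sym2.mem_iff.1 hv with rfl | rfl
        · exact Or.inr (Or.inl List.mem_cons_self)
        · exact Or.inr (Or.inr rfl)
    | cons y' r' =>
      intro e he v hv
      rcases (mem_fanPiece_cons_cons a).1 he with (rfl | rfl) | he'
      · rcases Sym2.mem_iff.1 hv with rfl | rfl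
        · exact Or.inl rfl
        · exact Or.inr (Or.inl List.mem_cons_self)
      · rcases Sym2.mem_iff.1 hv with rfl | rfl
        · exact Or.inr (Or.inl List.mem_cons_self)
        · exact Or.inr (Or.inl (List.mem_cons_of_mem _ List.mem_cons_self))
      · rcases ih e he' v hv with h1 | h1 | h1
        · exact Or.inl h1
        · exact Or.inr (Or.inl (List.mem_cons_of_mem _ h1))
        · exact Or.inr (Or.inr h1)

/-- In the all-open configuration of the piece over a nonempty list avoiding `a`, the far end `c` is joined to `a`
(along the spoke of the first vertex and the rim). [this work] -/
theorem reach_fanPiece (c : V) : ∀ (L : List V) (x : V), a ∉ x :: (L ++ [c]) → (x :: (L ++ [c])).Nodup →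
    (↑((List.toFinset (List.map (fun y => s(a, y)) (x :: L) ++ List.zipWith (fun y y' => s(y, y')) ((x :: L) ++ [c]) (List.tail ((x :: L) ++ [c]))))) : BondConfig V) ∈ {η : BondConfig V | c ∈ cl η.toFinset a} := by
  intro L
  induction L with
  | nil =>
    intro x hal hnd
    have hax : a ≠ x := fun h => hal (by rw [h]; exact List.mem_cons_self)
    have hxc : x ≠ c := by
      intro h; subst h; simp at hnd
    exact cl_coe_step _ (cl_coe_step _ (cl_coe_self _ a) ((mem_fanPiece_single a).2 (Or.inl rfl)) hax)
      ((mem_fanPiece_single a).2 (Or.inr rfl)) hxc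
  | cons y r ih =>
    intro x hal hnd
    have hal' : a ∉ y :: (r ++ [c]) := fun h => hal (List.mem_cons_of_mem _ h)
    have hnd' : (y :: (r ++ [c])).Nodup := (List.nodup_cons.1 hnd).2
    have key := ih y hal' hnd'
    simp only [Set.mem_setOf_eq] at key ⊢
    refine cl_toFinset_mono (fun e he => ?_) a key
    rw [Finset.mem_coe] at he ⊢
    exact (mem_fanPiece_cons_cons a).2 (Or.inr he)

end Support

/-! ### R1 on fan pieces -/

section Pieces

variable (a : V) {q : ℝ} (hq : 1 ≤ q)
include hq

/-- **R1-RC on fan pieces, every `q ≥ 1`** (see the module docstring): for the piece with apex `a` over `x :: l` with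
far end `c` (all distinct, avoiding `a`), positive parameters on the support and zero parameters off it,
`φ(T)·φ(S) ≤ φ(U_x)·φ(U_c)` for the instance `(a; x, c)`. [this work] -/
theorem fanPiece_r1 : ∀ (l : List V) (x c : V) (w : Sym2 V → unitInterval),
    (x :: (l ++ [c])).Nodup → a ∉ x :: (l ++ [c]) →
    (∀ e ∈ (List.toFinset (List.map (fun y => s(a, y)) (x :: l) ++ List.zipWith (fun y y' => s(y, y')) ((x :: l) ++ [c]) (List.tail ((x :: l) ++ [c])))), 0 < (w e : ℝ)) →
    (∀ e, e ∉ (↑((List.toFinset (List.map (fun y => s(a, y)) (x :: l) ++ List.zipWith (fun y y' => s(y, y')) ((x :: l) ++ [c]) (List.tail ((x :: l) ++ [c]))))) : Set (Sym2 V)) → (w e : ℝ) = 0) →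
    (rcMeasureW w q ∅).real {η : BondConfig V | x ∈ cl η.toFinset a ∧ c ∈ cl η.toFinset a} *
        (rcMeasureW w q ∅).real {η : BondConfig V | x ∉ cl η.toFinset a ∧ c ∉ cl η.toFinset a ∧
          Sep ((List.toFinset (List.map (fun y => s(a, y)) (x :: l) ++ List.zipWith (fun y y' => s(y, y')) ((x :: l) ++ [c]) (List.tail ((x :: l) ++ [c]))))) (cl η.toFinset a) x c} ≤
      (rcMeasureW w q ∅).real {η : BondConfig V | x ∈ cl η.toFinset a ∧ c ∉ cl η.toFinset a} *
        (rcMeasureW w q ∅).real {η : BondConfig V | x ∉ cl η.toFinset a ∧ c ∈ cl η.toFinset a} := by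
  have hq0 : 0 < q := one_pos.trans_le hq
  intro l
  induction l with
  | nil =>
    intro x c w hnd _ _ _
    have hxc : x ≠ c := by
      intro h; subst h; simp at hnd
    exact r1_of_adjacent w q _ hxc ((mem_fanPiece_single a).2 (Or.inr rfl))
  | cons y rest ih =>
    intro x c w hnd hal hpos hoff
    have hL : x :: ((y :: rest) ++ [c]) = x :: y :: (rest ++ [c]) := rfl
    rw [hL] at hnd hal
    -- distinctness facts
    have hx : x ∉ y :: (rest ++ [c]) := (List.nodup_cons.1 hnd).1
    have hnd' : (y :: (rest ++ [c])).Nodup := (List.nodup_cons.1 hnd).2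
    have hy : y ∉ rest ++ [c] := (List.nodup_cons.1 hnd').1
    have hcmem : c ∈ y :: (rest ++ [c]) :=
      List.mem_cons_of_mem _ (List.mem_append.2 (Or.inr (List.mem_singleton.2 rfl)))
    have hxy : x ≠ y := fun h => hx (by rw [h]; exact List.mem_cons_self)
    have hxc : x ≠ c := fun h => hx (by rw [h]; exact hcmem)
    have hyc : y ≠ c := fun h => hy (List.mem_append.2 (Or.inr (List.mem_singleton.2 h)))
    have hax : a ≠ x := fun h => hal (by rw [h]; exact List.mem_cons_self)
    have hay : a ≠ y := fun h => hal (by rw [h]; exact List.mem_cons_of_mem _ List.mem_cons_self)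
    have hac : a ≠ c := fun h => hal (by rw [h]; exact List.mem_cons_of_mem _ hcmem)
    have hal' : a ∉ y :: (rest ++ [c]) := fun h => hal (List.mem_cons_of_mem _ h)
    -- the two arms
    set DX : Finset (Sym2 V) := {s(a, x), s(x, y)} with hDX
    set DY : Finset (Sym2 V) := (List.toFinset (List.map (fun y => s(a, y)) (y :: rest) ++ List.zipWith (fun y y' => s(y, y')) ((y :: rest) ++ [c]) (List.tail ((y :: rest) ++ [c])))) with hDY
    have hD : ∀ e, e ∈ (List.toFinset (List.map (fun y => s(a, y)) (x :: y :: rest) ++ List.zipWith (fun y y' => s(y, y')) ((x :: y :: rest) ++ [c]) (List.tail ((x :: y :: rest) ++ [c])))) ↔ e ∈ DX ∨ e ∈ DY := by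
      intro e
      rw [mem_fanPiece_cons_cons, hDX, Finset.mem_insert, Finset.mem_singleton]
    have vertsY := verts_fanPiece a c (y :: rest)
    have hyrc : ∀ v, (v ∈ y :: rest ∨ v = c) → v ∈ y :: (rest ++ [c]) := by
      rintro v (hv | rfl)
      · rcases List.mem_cons.1 hv with rfl | hv
        · exact List.mem_cons_self
        · exact List.mem_cons_of_mem _ (List.mem_append.2 (Or.inl hv))
      · exact hcmem
    have hsepD : ∀ v : V, (∃ e ∈ DX, v ∈ e) → (∃ e ∈ DY, v ∈ e) → (v = a ∨ v = y) := by
      rintro v ⟨e, he, hve⟩ ⟨e', he', hve'⟩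
      rcases vertsY e' he' v hve' with h1 | h1
      · exact Or.inl h1
      · have h2 := hyrc v h1
        rw [hDX, Finset.mem_insert, Finset.mem_singleton] at he
        rcases he with rfl | rfl
        · rcases Sym2.mem_iff.1 hve with rfl | rfl
          · exact Or.inl rfl
          · exact absurd h2 hx
        · rcases Sym2.mem_iff.1 hve with rfl | rfl
          · exact absurd h2 hx
          · exact Or.inr rfl
    have hbY : ∀ e ∈ DY, x ∉ e := fun e he hxe => by
      rcases vertsY e he x hxe with h1 | h1
      · exact hax h1.symm
      · exact hx (hyrc x h1)
    have hcX : ∀ e ∈ DX, c ∉ e := fun e he hce => by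
      rw [hDX, Finset.mem_insert, Finset.mem_singleton] at he
      rcases he with rfl | rfl
      · rcases Sym2.mem_iff.1 hce with h1 | h1
        · exact hac h1.symm
        · exact hxc h1.symm
      · rcases Sym2.mem_iff.1 hce with h1 | h1
        · exact hxc h1.symm
        · exact hyc h1.symm
    have hdisj : ∀ e ∈ DY, e ∉ DX := fun e he heX => by
      rw [hDX, Finset.mem_insert, Finset.mem_singleton] at heX
      rcases heX with rfl | rfl
      · exact hbY _ he (Sym2.mem_mk_right a x)
      · exact hbY _ he (Sym2.mem_mk_left x y)
    -- the arm parameters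
    set wX : Sym2 V → unitInterval := fun e => if e ∈ (↑DX : Set (Sym2 V)) then w e else 0 with hwX
    set wY : Sym2 V → unitInterval := fun e => if e ∈ (↑DX : Set (Sym2 V)) then 0 else w e with hwY
    have hX : ∀ e ∈ (↑DX : Set (Sym2 V)), wX e = w e := fun e he => by simp only [hwX, if_pos he]
    have hX' : ∀ e ∉ (↑DX : Set (Sym2 V)), wX e = 0 := fun e he => by simp only [hwX, if_neg he]
    have hY : ∀ e ∈ (↑DX : Set (Sym2 V)), wY e = 0 := fun e he => by simp only [hwY, if_pos he]
    have hY' : ∀ e ∉ (↑DX : Set (Sym2 V)), wY e = w e := fun e he => by simp only [hwY, if_neg he]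
    have hw : ∀ e, e ∉ (↑DX ∪ ↑DY : Set (Sym2 V)) → (w e : ℝ) = 0 := fun e he =>
      hoff e (fun he' => he (by
        rw [Finset.mem_coe] at he'
        rcases (hD e).1 he' with h1 | h1
        · exact Or.inl h1
        · exact Or.inr h1))
    have hposX : ∀ e ∈ DX, 0 < (wX e : ℝ) := fun e he => by
      rw [hX e (Finset.mem_coe.2 he)]
      exact hpos e ((hD e).2 (Or.inl he))
    have hoffX : ∀ e ∉ (↑DX : Set (Sym2 V)), (wX e : ℝ) = 0 := fun e he => by rw [hX' e he]; rfl
    have hposY : ∀ e ∈ DY, 0 < (wY e : ℝ) := fun e he => by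
      rw [hY' e (fun he' => hdisj e he (Finset.mem_coe.1 he'))]
      exact hpos e ((hD e).2 (Or.inr he))
    have hoffY : ∀ e ∉ (↑DY : Set (Sym2 V)), (wY e : ℝ) = 0 := fun e he => by
      by_cases heX : e ∈ (↑DX : Set (Sym2 V))
      · rw [hY e heX]; rfl
      · rw [hY' e heX]
        exact hoff e (fun he' => by
          rw [Finset.mem_coe] at he'
          rcases (hD e).1 he' with h1 | h1
          · exact heX (Finset.mem_coe.2 h1)
          · exact he (Finset.mem_coe.2 h1))
    -- arm X: the path `a – x – y`
    have hxyX : s(x, y) ∈ DX := by rw [hDX]; simp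
    have haxX : s(a, x) ∈ DX := by rw [hDX]; simp
    have hR1X := r1_of_adjacent (a := a) wX q DX hxy hxyX
    have hFX := fkg_slack_of_one_le (a := a) (h := y) (t := x) wX hq
    have hAX : (rcMeasureW wX q ∅).real {η : BondConfig V | x ∈ cl η.toFinset a ∧ y ∈ cl η.toFinset a} ≠ 0 :=
      ne_of_gt (real_pos_of_support wX hq0 DX hposX hoffX
        ⟨cl_coe_step DX (cl_coe_self DX a) haxX hax,
         cl_coe_step DX (cl_coe_step DX (cl_coe_self DX a) haxX hax) hxyX hxy⟩)
    -- arm Y: the piece over `y :: rest`, by induction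
    have hR1Y' := ih y c wY hnd' hal' hposY hoffY
    have hR1Y := r1_symm (a := a) wY q DY hR1Y'
    have hFY := fkg_slack_of_one_le (a := a) (h := y) (t := c) wY hq
    have hAY : (rcMeasureW wY q ∅).real {η : BondConfig V | c ∈ cl η.toFinset a ∧ y ∈ cl η.toFinset a} ≠ 0 :=
      ne_of_gt (real_pos_of_support wY hq0 DY hposY hoffY
        ⟨reach_fanPiece a c rest y hal' hnd',
         cl_coe_step DY (cl_coe_self DY a) (spoke_mem_fanPiece a List.mem_cons_self) hay⟩)
    -- glue
    exact r1_of_apexTwoSum hay hax hac hxc (Ne.symm hxy) hyc hsepD hbY hcX hD w wX wY hq0 hw hX hX' hY hY'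
      hR1X hFX hAX hR1Y hFY hAY

end Pieces

end ApexTwoSum

end Summit.CriticalPhenomena.PercolationContinuityZ3.Theorems
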